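import Summits.CriticalPhenomena.PercolationContinuityZ3.Theorems.PercNearOneGluingNoHeavyLowerTailSahiT2Square
import Summits.CriticalPhenomena.PercolationContinuityZ3.Theorems.PercNearOneGluingNoHeavyLowerTailSahiT2SquareRules
import Summits.CriticalPhenomena.PercolationContinuityZ3.Theorems.PercNearOneGluingNoHeavyLowerTailSahiT2SquareCorner00
import Summits.CriticalPhenomena.PercolationContinuityZ3.Theorems.PercNearOneGluingNoHeavyLowerTailSahiHubTwoLevelSquareRules
import Summits.CriticalPhenomena.PercolationContinuityZ3.Theorems.PercNearOneGluingNoHeavyLowerTailSahiHubTwoLevelI3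
import Mathlib.Tactic.Linarith
import Mathlib.Tactic.Positivity
import Mathlib.Tactic.FieldSimp
import Mathlib.Tactic.Ring
import HarnessLib

/-!
# `NoHeavyLowerTail` (crux stmt-CriticalPhenomena-4575), P2 — THE `(2,2)` ATOM: THE THREE UPPER CORNER ATOMS ARE NONNEGATIVE

Seat `prim-masterthm-p2`, gen 29 (memo `FROM-prim-masterthm-p2-g29-SQUARE-IDENTITY.md` §9; `--supports stmt-CriticalPhenomena-4575`).
No `sorry`, no named facts, standard axioms.

For the `(2,2)` triple `f(z₁,z₂,a), g(z₁,z₂,b), h(z₁,z₂,a,b)` (`…SahiT2Square`): FKG blocks `α, β`; `f, g ≥ 0` monotone on the square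
`(z₁,z₂)` and in their block argument; `h ≥ 0` monotone on the square and in each block argument.  THEN the corner atoms
`Main − Hpart_11`, `Main − Hpart_10`, `Main − Hpart_01` are `≥ 0` (`atoms_upper_nonneg`).  Proof = the box identity `main_eq_square`
with the gen-29 ratio rule (four regimes A1/A2/B1/B2 by `G_Z ≶ G_C`, `F_Z ≶ F_C`; degenerate `F_T = 0` apart): `S^ρ(b) ≥ 0` fibrewise
by the layer cake `SahiHubTwoLevel.sq_core` and the point-`H` pattern certificates `t2pat*` (`…SahiT2SquareRules`), `CP ≥ 0`
(`CPart2_nonneg`), and the corner remainders by `t2R11_*`, `t2R10_*`, `t2R01_*` (`…SahiT2SquareRemainders/Corner00`).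
The fourth corner `(0,0)` enters the `(2,2)` theorem only through the joint Bernstein coefficient `β₁₁` (memo §9; next file). [this work]
-/

noncomputable section

open scoped Classical

namespace Summit.CriticalPhenomena.PercolationContinuityZ3.Theorems

namespace SahiT2Square

open Finset Literature.Combinatorics.Sahi2008
open SahiHubTwoLevel (Fm gm rhoOf rhoOf_val sq_core Fm_nonneg Fm_mono_i Fm_sub_nonneg gm_mono_j gm_sub_nonneg
  mul_eq_zero_of_Fm_eq_zero)

variable {α β : Type} [Fintype α] [Fintype β]
  {wA : α → ℝ} {wB : β → ℝ} {f : Fin 2 → Fin 2 → α → ℝ} {g : Fin 2 → Fin 2 → β → ℝ} {h : Fin 2 → Fin 2 → α → β → ℝ}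

omit [Fintype β] in
/-- `F_x = 0 ⟹ Y_x(b) = 0`. -/
theorem Ysl2_eq_zero_of_Fm_eq_zero (hA0 : ∀ a, 0 ≤ wA a) (hf0 : ∀ z₁ z₂ a, 0 ≤ f z₁ z₂ a) {z₁ z₂ : Fin 2}
    (hz : Fm wA f z₁ z₂ = 0) (b : β) : Ysl2 wA f h z₁ z₂ b = 0 := by
  unfold Ysl2
  refine sum_eq_zero fun a _ => ?_
  have : wA a * f z₁ z₂ a = 0 := mul_eq_zero_of_Fm_eq_zero hA0 hf0 hz a
  calc wA a * (f z₁ z₂ a * h z₁ z₂ a b) = (wA a * f z₁ z₂ a) * h z₁ z₂ a b := by ring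
    _ = 0 := by rw [this, zero_mul]

/-- From the box identity: `S^ρ ≥ 0` fibrewise, `CP(ρ) ≥ 0` and `Rlin ρ − Hp ≥ 0` give `Main − Hp ≥ 0`. -/
theorem main_sub_nonneg_of (hB0 : ∀ b, 0 ≤ wB b) {ρ : Fin 2 → Fin 2 → ℝ} {Hp : ℝ}
    (hS : ∀ b, 0 ≤ Sbox2 wA f g h ρ b) (hCP : 0 ≤ CPart2 wA wB f g h ρ) (hR : 0 ≤ Rlin wA wB f g h ρ - Hp) :
    0 ≤ Main wA wB f g h - Hp := by
  rw [main_eq_square ρ]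
  have : 0 ≤ ∑ b, wB b * Sbox2 wA f g h ρ b := sum_nonneg fun b _ => mul_nonneg (hB0 b) (hS b)
  linarith

/-- **The three upper corner atoms are nonnegative.** -/
theorem atoms_upper_nonneg [DistribLattice α] [DistribLattice β] (hA : IsFKGMeasure wA) (hB : IsFKGMeasure wB)
    (hf0 : ∀ z₁ z₂ a, 0 ≤ f z₁ z₂ a) (hf1 : ∀ z₂ a, f 0 z₂ a ≤ f 1 z₂ a) (hf2 : ∀ z₁ a, f z₁ 0 a ≤ f z₁ 1 a)
    (hfa : ∀ z₁ z₂, Monotone (f z₁ z₂))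
    (hg0 : ∀ z₁ z₂ b, 0 ≤ g z₁ z₂ b) (hg1 : ∀ z₂ b, g 0 z₂ b ≤ g 1 z₂ b) (hg2 : ∀ z₁ b, g z₁ 0 b ≤ g z₁ 1 b)
    (hgb : ∀ z₁ z₂, Monotone (g z₁ z₂))
    (hh0 : ∀ z₁ z₂ a b, 0 ≤ h z₁ z₂ a b) (hh1 : ∀ z₂ a b, h 0 z₂ a b ≤ h 1 z₂ a b) (hh2 : ∀ z₁ a b, h z₁ 0 a b ≤ h z₁ 1 a b)
    (hha : ∀ z₁ z₂ b, Monotone (fun a => h z₁ z₂ a b)) (hhb : ∀ z₁ z₂ a, Monotone (h z₁ z₂ a)) :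
    0 ≤ Main wA wB f g h - Hpart11 wA wB f g h ∧ 0 ≤ Main wA wB f g h - Hpart10 wA wB f g h
      ∧ 0 ≤ Main wA wB f g h - Hpart01 wA wB f g h := by
  have hA0 := hA.nonneg; have hB0 := hB.nonneg
  -- square order facts: 0=(0,0), Z=(1,0), C=(0,1), T=(1,1)
  have f0 : 0 ≤ Fm wA f 0 0 := Fm_nonneg hA0 hf0 0 0
  have f0Z : Fm wA f 0 0 ≤ Fm wA f 1 0 := Fm_mono_i hA0 hf1 0
  have f0C : Fm wA f 0 0 ≤ Fm wA f 0 1 := by have := Fm_sub_nonneg hA0 hf2 0; linarith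
  have fZT : Fm wA f 1 0 ≤ Fm wA f 1 1 := by have := Fm_sub_nonneg hA0 hf2 1; linarith
  have fCT : Fm wA f 0 1 ≤ Fm wA f 1 1 := Fm_mono_i hA0 hf1 1
  have g0Z : gm wB g 0 0 ≤ gm wB g 1 0 := gm_mono_j hB0 hg1 0
  have g0C : gm wB g 0 0 ≤ gm wB g 0 1 := by have := gm_sub_nonneg hB0 hg2 0; linarith
  have gZT : gm wB g 1 0 ≤ gm wB g 1 1 := by have := gm_sub_nonneg hB0 hg2 1; linarith
  have gCT : gm wB g 0 1 ≤ gm wB g 1 1 := gm_mono_j hB0 hg1 1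
  have hb0Z : Hb2 wA wB h 0 0 ≤ Hb2 wA wB h 1 0 := Hb2_mono_pt hA0 hB0 (fun a b => hh1 0 a b)
  have hb0C : Hb2 wA wB h 0 0 ≤ Hb2 wA wB h 0 1 := Hb2_mono_pt hA0 hB0 (fun a b => hh2 0 a b)
  have hbZT : Hb2 wA wB h 1 0 ≤ Hb2 wA wB h 1 1 := Hb2_mono_pt hA0 hB0 (fun a b => hh2 1 a b)
  have hbCT : Hb2 wA wB h 0 1 ≤ Hb2 wA wB h 1 1 := Hb2_mono_pt hA0 hB0 (fun a b => hh1 1 a b)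
  have yZT : Ybar2 wA wB f h 1 0 ≤ Ybar2 wA wB f h 1 1 := Ybar2_mono_pt hA0 hB0 hf0 hh0 (fun a => hf2 1 a) (fun a b => hh2 1 a b)
  have yCT : Ybar2 wA wB f h 0 1 ≤ Ybar2 wA wB f h 1 1 := Ybar2_mono_pt hA0 hB0 hf0 hh0 (fun a => hf1 1 a) (fun a b => hh1 1 a b)
  have sbT := Fm_mul_Hb2_le_Ybar2 hA hB0 hf0 hfa hh0 hha 1 1
  have sbZ := Fm_mul_Hb2_le_Ybar2 hA hB0 hf0 hfa hh0 hha 1 0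
  have sbC := Fm_mul_Hb2_le_Ybar2 hA hB0 hf0 hfa hh0 hha 0 1
  -- fibre facts
  have sl := Fm_mul_Hsl2_le_Ysl2 (h := h) hA hf0 hfa hh0 hha
  have mZ0 : ∀ b, Ysl2 wA f h 0 0 b ≤ Ysl2 wA f h 1 0 b := Ysl2_mono_pt hA0 hf0 hh0 (fun a => hf1 0 a) (fun a b => hh1 0 a b)
  have mC0 : ∀ b, Ysl2 wA f h 0 0 b ≤ Ysl2 wA f h 0 1 b := Ysl2_mono_pt hA0 hf0 hh0 (fun a => hf2 0 a) (fun a b => hh2 0 a b)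
  have mTZ : ∀ b, Ysl2 wA f h 1 0 b ≤ Ysl2 wA f h 1 1 b := Ysl2_mono_pt hA0 hf0 hh0 (fun a => hf2 1 a) (fun a b => hh2 1 a b)
  have mTC : ∀ b, Ysl2 wA f h 0 1 b ≤ Ysl2 wA f h 1 1 b := Ysl2_mono_pt hA0 hf0 hh0 (fun a => hf1 1 a) (fun a b => hh1 1 a b)
  have hH0 := Hsl2_nonneg hA0 hh0 0 0
  have eZ0 : ∀ b, Hsl2 wA h 0 0 b ≤ Hsl2 wA h 1 0 b := Hsl2_mono_pt hA0 (fun a b => hh1 0 a b)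
  have eC0 : ∀ b, Hsl2 wA h 0 0 b ≤ Hsl2 wA h 0 1 b := Hsl2_mono_pt hA0 (fun a b => hh2 0 a b)
  have eTZ : ∀ b, Hsl2 wA h 1 0 b ≤ Hsl2 wA h 1 1 b := Hsl2_mono_pt hA0 (fun a b => hh2 1 a b)
  have eTC : ∀ b, Hsl2 wA h 0 1 b ≤ Hsl2 wA h 1 1 b := Hsl2_mono_pt hA0 (fun a b => hh1 1 a b)
  have cp : ∀ {ρ : Fin 2 → Fin 2 → ℝ}, (∀ z₁ z₂, 0 ≤ ρ z₁ z₂) → (∀ z₁ z₂, ρ z₁ z₂ ≤ 1) → 0 ≤ CPart2 wA wB f g h ρ :=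
    fun h0 h1 => CPart2_nonneg hB hA0 hf0 hg0 hgb hh0 hhb h0 h1
  -- abbreviations
  set F0 := Fm wA f 0 0 with hF0d; set FZ := Fm wA f 1 0 with hFZd; set FC := Fm wA f 0 1 with hFCd; set FT := Fm wA f 1 1 with hFTd
  -- degenerate case F_T = 0
  by_cases hT : FT = 0
  · have hall : ∀ z₁ z₂, Fm wA f z₁ z₂ = 0 := by
      intro z₁ z₂; fin_cases z₁ <;> fin_cases z₂ <;> simp <;> linarith
    have hY : ∀ z₁ z₂ b, Ysl2 wA f h z₁ z₂ b = 0 := fun z₁ z₂ b => Ysl2_eq_zero_of_Fm_eq_zero hA0 hf0 (hall z₁ z₂) b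
    have hYb : ∀ z₁ z₂, Ybar2 wA wB f h z₁ z₂ = 0 := fun z₁ z₂ => by
      unfold Ybar2; exact sum_eq_zero fun b _ => by rw [hY]; ring
    have hS : ∀ b, 0 ≤ Sbox2 wA f g h (fun _ _ => 0) b := fun b => by simp [Sbox2, hY, hall]
    have hCP := cp (ρ := fun _ _ => 0) (fun _ _ => le_refl _) (fun _ _ => zero_le_one)
    have hk : ∀ z₁ z₂ y₁ y₂, kap wA wB f g z₁ z₂ y₁ y₂ = 0 := fun _ _ _ _ => by unfold kap; rw [hall, hall]; ring
    have hchi : chi wA wB f g = 0 := by unfold chi; rw [hk, hk]; ring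
    have hRl : Rlin wA wB f g h (fun _ _ => 0) = 0 := by unfold Rlin; ring
    refine ⟨main_sub_nonneg_of hB0 hS hCP ?_, main_sub_nonneg_of hB0 hS hCP ?_, main_sub_nonneg_of hB0 hS hCP ?_⟩
    · rw [hRl]; unfold Hpart11; rw [hchi, hk, hk]; simp
    · rw [hRl]; unfold Hpart10; rw [hchi, hk, hk]; simp
    · rw [hRl]; unfold Hpart01; rw [hchi, hk, hk]; simp
  have hTpos : 0 < FT := lt_of_le_of_ne (Fm_nonneg hA0 hf0 1 1) (Ne.symm hT)
  have r11 : 0 ≤ 1 - F0 / FT := by rw [sub_nonneg, div_le_one hTpos]; linarith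
  have r11' : 1 - F0 / FT ≤ 1 := by have := div_nonneg f0 hTpos.le; linarith
  -- common pattern facts
  have pT : ∀ b, 0 ≤ (2 - (1 - F0 / FT)) * Ysl2 wA f h 1 1 b - F0 * Hsl2 wA h 1 1 b - (1 - 0) * Ysl2 wA f h 0 0 b :=
    fun b => t2patT hTpos f0 (sl 1 1 b) (mZ0 b) (mTZ b)
  by_cases hG : gm wB g 0 1 ≤ gm wB g 1 0
  · -- case A : G_C ≤ G_Z
    by_cases hF : FZ ≤ FC
    · -- A1: ρ_C = (F_C − F_Z)/F_T
      let ρ := rhoOf 0 ((FC - FZ) / FT) 0 (1 - F0 / FT)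
      obtain ⟨e00, e01, e10, e11⟩ := rhoOf_val 0 ((FC - FZ) / FT) 0 (1 - F0 / FT)
      have rC : 0 ≤ (FC - FZ) / FT := div_nonneg (sub_nonneg.2 hF) hTpos.le
      have rC' : (FC - FZ) / FT ≤ 1 := by rw [div_le_one hTpos]; linarith
      have hρ0 : ∀ z₁ z₂, 0 ≤ ρ z₁ z₂ := by intro z₁ z₂; fin_cases z₁ <;> fin_cases z₂ <;> first | exact le_refl _ | assumption
      have hρ1 : ∀ z₁ z₂, ρ z₁ z₂ ≤ 1 := by
        intro z₁ z₂; fin_cases z₁ <;> fin_cases z₂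
        · exact zero_le_one
        · exact rC'
        · exact zero_le_one
        · exact r11'
      have hS : ∀ b, 0 ≤ Sbox2 wA f g h ρ b := fun b => by
        unfold Sbox2; simp only [ρ, e00, e01, e10, e11]
        have p2 := t2patZT_A1 hTpos f0 hF (by linarith) (eTZ b) (sl 1 0 b) (sl 1 1 b) (mZ0 b) (mTC b)
        have p3 := t2patCT_A1 hTpos f0 hF fCT (by linarith) (le_trans (hH0 b) (eC0 b)) (sl 0 1 b) (sl 1 1 b) (mC0 b) (mTZ b)
        have p4 := t2patZCT_le (ρZ := (0:ℝ)) (ρC := (FC - FZ) / FT) hTpos f0 hF fCT fZT (hH0 b) (eZ0 b) (eC0 b) (eTZ b)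
          (sl 0 1 b) (sl 1 1 b) (mZ0 b)
        have p5 := t2patAll_le (ρZ := (0:ℝ)) (ρC := (FC - FZ) / FT) (ρT := 1 - F0 / FT) (le_trans f0Z fZT) hF (by linarith)
          (eZ0 b) (eC0 b) (eTZ b) (sl 0 0 b) (sl 1 0 b) (sl 0 1 b) (sl 1 1 b)
        exact sq_core (hg0 0 0 b) (hg1 0 b) (hg2 0 b) (hg2 1 b) (hg1 1 b) (pT b) p2 p3 p4 (by linarith)
      have hCP := cp hρ0 hρ1
      refine ⟨main_sub_nonneg_of hB0 hS hCP ?_, main_sub_nonneg_of hB0 hS hCP ?_, main_sub_nonneg_of hB0 hS hCP ?_⟩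
      · have key := t2R11_A1 (YbC := Ybar2 wA wB f h 0 1) hTpos f0Z hF fCT g0C hG gZT hbZT hbCT yCT sbT
        rw [R11_eq]; simp only [ρ, e00, e01, e10, e11]
        unfold DT0r DZC_A1 at key; linarith
      · have key := t2R10_A1 (YbC := Ybar2 wA wB f h 0 1) hTpos f0Z hF fCT g0C hG gZT hb0Z hbZT yCT sbT
        rw [R10_eq]; simp only [ρ, e00, e01, e10, e11]
        unfold DT0r DZC_A1 at key; linarith
      · have key := t2R01_A1 (YbC := Ybar2 wA wB f h 0 1) hTpos f0Z hF fCT g0C hG gZT hb0C hbCT yCT sbT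
        rw [R01_eq]; simp only [ρ, e00, e01, e10, e11]
        unfold DT0r DZC_A1 at key; linarith
    · -- A2: ρ_Z = 1 − F_C/F_Z, F_C < F_Z
      have hF' : FC ≤ FZ := le_of_lt (not_le.mp hF)
      have hZpos : 0 < FZ := lt_of_le_of_lt (le_trans f0 f0C) (not_le.mp hF)
      have fC0 : 0 ≤ FC := le_trans f0 f0C
      let ρ := rhoOf 0 0 (1 - FC / FZ) (1 - F0 / FT)
      obtain ⟨e00, e01, e10, e11⟩ := rhoOf_val 0 0 (1 - FC / FZ) (1 - F0 / FT)
      have rZ : 0 ≤ 1 - FC / FZ := by rw [sub_nonneg, div_le_one hZpos]; exact hF'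
      have rZ' : 1 - FC / FZ ≤ 1 := by have := div_nonneg fC0 hZpos.le; linarith
      have hρ0 : ∀ z₁ z₂, 0 ≤ ρ z₁ z₂ := by intro z₁ z₂; fin_cases z₁ <;> fin_cases z₂ <;> first | exact le_refl _ | assumption
      have hρ1 : ∀ z₁ z₂, ρ z₁ z₂ ≤ 1 := by
        intro z₁ z₂; fin_cases z₁ <;> fin_cases z₂
        · exact zero_le_one
        · exact zero_le_one
        · exact rZ'
        · exact r11'
      have hS : ∀ b, 0 ≤ Sbox2 wA f g h ρ b := fun b => by
        unfold Sbox2; simp only [ρ, e00, e01, e10, e11]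
        have p2 := t2patZT_A2 hTpos hZpos f0 fC0 (sl 1 0 b) (sl 1 1 b) (mZ0 b) (mTC b)
        have p3 := t2patCT_A2 hTpos hZpos f0 fC0 hF' fZT (le_trans (le_trans (hH0 b) (eZ0 b)) (eTZ b)) (eTC b)
          (sl 0 1 b) (sl 1 1 b) (mC0 b) (mTZ b)
        have p4 := t2patZCT_ge (ρZ := 1 - FC / FZ) (ρC := (0:ℝ)) hTpos f0 hF' fZT fCT (hH0 b) (eZ0 b) (eC0 b) (eTC b)
          (sl 1 0 b) (sl 1 1 b) (mC0 b)
        have p5 := t2patAll_ge (ρZ := 1 - FC / FZ) (ρC := (0:ℝ)) (ρT := 1 - F0 / FT) (le_trans f0Z fZT) hF' (by linarith)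
          (eZ0 b) (eC0 b) (eTC b) (sl 0 0 b) (sl 1 0 b) (sl 0 1 b) (sl 1 1 b)
        exact sq_core (hg0 0 0 b) (hg1 0 b) (hg2 0 b) (hg2 1 b) (hg1 1 b) (pT b) p2 p3 p4 (by linarith)
      have hCP := cp hρ0 hρ1
      refine ⟨main_sub_nonneg_of hB0 hS hCP ?_, main_sub_nonneg_of hB0 hS hCP ?_, main_sub_nonneg_of hB0 hS hCP ?_⟩
      · have key := t2R11_A2 (YbZ := Ybar2 wA wB f h 1 0) hTpos hZpos (le_trans f0Z fZT) hF' fZT fCT (le_trans g0Z gZT) hG gZT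
          hbZT hbCT sbZ sbT
        rw [R11_eq]; simp only [ρ, e00, e01, e10, e11]
        unfold DT0r DZC_A2 at key; linarith
      · have key := t2R10_A2 (YbZ := Ybar2 wA wB f h 1 0) hTpos hZpos f0Z hF' fZT g0Z hG gZT hb0Z hbZT sbZ sbT
        rw [R10_eq]; simp only [ρ, e00, e01, e10, e11]
        unfold DT0r DZC_A2 at key; linarith
      · have key := t2R01_A2 (YbZ := Ybar2 wA wB f h 1 0) hTpos hZpos f0C hF' fZT fCT g0C hG gZT hb0Z hb0C hbCT sbZ sbT
        rw [R01_eq]; simp only [ρ, e00, e01, e10, e11]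
        unfold DT0r DZC_A2 at key; linarith
  · -- case B : G_Z < G_C
    have hG' : gm wB g 1 0 ≤ gm wB g 0 1 := le_of_lt (not_le.mp hG)
    by_cases hF : FZ < FC
    · -- B1: ρ_C = (F_C − F_Z)/F_C
      have hCpos : 0 < FC := lt_of_le_of_lt (le_trans f0 f0Z) hF
      have fZ0 : 0 ≤ FZ := le_trans f0 f0Z
      let ρ := rhoOf 0 ((FC - FZ) / FC) 0 (1 - F0 / FT)
      obtain ⟨e00, e01, e10, e11⟩ := rhoOf_val 0 ((FC - FZ) / FC) 0 (1 - F0 / FT)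
      have rC : 0 ≤ (FC - FZ) / FC := div_nonneg (sub_nonneg.2 hF.le) hCpos.le
      have rC' : (FC - FZ) / FC ≤ 1 := by rw [div_le_one hCpos]; linarith
      have hρ0 : ∀ z₁ z₂, 0 ≤ ρ z₁ z₂ := by intro z₁ z₂; fin_cases z₁ <;> fin_cases z₂ <;> first | exact le_refl _ | assumption
      have hρ1 : ∀ z₁ z₂, ρ z₁ z₂ ≤ 1 := by
        intro z₁ z₂; fin_cases z₁ <;> fin_cases z₂
        · exact zero_le_one
        · exact rC'
        · exact zero_le_one
        · exact r11'
      have hS : ∀ b, 0 ≤ Sbox2 wA f g h ρ b := fun b => by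
        unfold Sbox2; simp only [ρ, e00, e01, e10, e11]
        have p2 := t2patZT_B1 hTpos hCpos f0 fZ0 hF.le fCT (le_trans (le_trans (hH0 b) (eZ0 b)) (eTZ b)) (eTZ b)
          (sl 1 0 b) (sl 1 1 b) (mZ0 b) (mTC b)
        have p3 := t2patCT_B1 hTpos hCpos f0 fZ0 (sl 0 1 b) (sl 1 1 b) (mC0 b) (mTZ b)
        have p4 := t2patZCT_le (ρZ := (0:ℝ)) (ρC := (FC - FZ) / FC) hTpos f0 hF.le fCT fZT (hH0 b) (eZ0 b) (eC0 b) (eTZ b)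
          (sl 0 1 b) (sl 1 1 b) (mZ0 b)
        have p5 := t2patAll_le (ρZ := (0:ℝ)) (ρC := (FC - FZ) / FC) (ρT := 1 - F0 / FT) (le_trans f0Z fZT) hF.le (by linarith)
          (eZ0 b) (eC0 b) (eTZ b) (sl 0 0 b) (sl 1 0 b) (sl 0 1 b) (sl 1 1 b)
        exact sq_core (hg0 0 0 b) (hg1 0 b) (hg2 0 b) (hg2 1 b) (hg1 1 b) (pT b) p2 p3 p4 (by linarith)
      have hCP := cp hρ0 hρ1
      refine ⟨main_sub_nonneg_of hB0 hS hCP ?_, main_sub_nonneg_of hB0 hS hCP ?_, main_sub_nonneg_of hB0 hS hCP ?_⟩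
      · have key := t2R11_B1 (YbC := Ybar2 wA wB f h 0 1) hTpos hCpos (le_trans f0Z fZT) hF.le fCT fZT (le_trans g0Z gZT) hG' gCT
          hbZT hbCT sbC sbT
        rw [R11_eq]; simp only [ρ, e00, e01, e10, e11]
        unfold DT0r DZC_B1 at key; linarith
      · have key := t2R10_B1 (YbC := Ybar2 wA wB f h 0 1) hTpos hCpos f0Z hF.le fCT g0Z hG' gCT hb0Z hb0C hbZT sbC sbT
        rw [R10_eq]; simp only [ρ, e00, e01, e10, e11]
        unfold DT0r DZC_B1 at key; linarith
      · have key := t2R01_B1 (YbC := Ybar2 wA wB f h 0 1) hTpos hCpos f0C hF.le fCT (le_trans g0Z gZT) hG' gCT hb0C hbCT sbC sbT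
        rw [R01_eq]; simp only [ρ, e00, e01, e10, e11]
        unfold DT0r DZC_B1 at key; linarith
    · -- B2: ρ_Z = (F_Z − F_C)/F_T, F_C ≤ F_Z
      have hF' : FC ≤ FZ := not_lt.mp hF
      let ρ := rhoOf 0 0 ((FZ - FC) / FT) (1 - F0 / FT)
      obtain ⟨e00, e01, e10, e11⟩ := rhoOf_val 0 0 ((FZ - FC) / FT) (1 - F0 / FT)
      have rZ : 0 ≤ (FZ - FC) / FT := div_nonneg (sub_nonneg.2 hF') hTpos.le
      have rZ' : (FZ - FC) / FT ≤ 1 := by rw [div_le_one hTpos]; linarith [le_trans f0 f0C]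
      have hρ0 : ∀ z₁ z₂, 0 ≤ ρ z₁ z₂ := by intro z₁ z₂; fin_cases z₁ <;> fin_cases z₂ <;> first | exact le_refl _ | assumption
      have hρ1 : ∀ z₁ z₂, ρ z₁ z₂ ≤ 1 := by
        intro z₁ z₂; fin_cases z₁ <;> fin_cases z₂
        · exact zero_le_one
        · exact zero_le_one
        · exact rZ'
        · exact r11'
      have hS : ∀ b, 0 ≤ Sbox2 wA f g h ρ b := fun b => by
        unfold Sbox2; simp only [ρ, e00, e01, e10, e11]
        have p2 : 0 ≤ (2 - (FZ - FC) / FT) * Ysl2 wA f h 1 0 b - FC * Hsl2 wA h 1 0 b - (1 - 0) * Ysl2 wA f h 0 1 b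
            + ((2 - (1 - F0 / FT)) * Ysl2 wA f h 1 1 b - F0 * Hsl2 wA h 1 1 b - (1 - 0) * Ysl2 wA f h 0 0 b) := by
          by_cases hZ0 : FZ = 0
          · have hC0 : FC = 0 := le_antisymm (by linarith) (le_trans f0 f0C)
            have h00 : F0 = 0 := le_antisymm (by linarith) f0
            have := t2patZT_B2_zero (YZ := Ysl2 wA f h 1 0 b) (YC := Ysl2 wA f h 0 1 b) (HZ := Hsl2 wA h 1 0 b)
              (HT := Hsl2 wA h 1 1 b) hTpos (Ysl2_nonneg hA0 hf0 hh0 0 0 b) (mZ0 b) (mTC b)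
            rw [hZ0, hC0, h00]; simpa using this
          · have hZpos : 0 < FZ := lt_of_le_of_ne (le_trans f0 f0Z) (Ne.symm hZ0)
            exact t2patZT_B2 hTpos hZpos f0 (le_trans f0 f0C) hF' fZT (le_trans (hH0 b) (eZ0 b)) (sl 1 0 b) (sl 1 1 b) (mZ0 b) (mTC b)
        have p3 := t2patCT_B2 hTpos f0 hF' (by linarith [le_trans f0 f0C]) (eTC b) (sl 0 1 b) (sl 1 1 b) (mC0 b) (mTZ b)
        have p4 := t2patZCT_ge (ρZ := (FZ - FC) / FT) (ρC := (0:ℝ)) hTpos f0 hF' fZT fCT (hH0 b) (eZ0 b) (eC0 b) (eTC b)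
          (sl 1 0 b) (sl 1 1 b) (mC0 b)
        have p5 := t2patAll_ge (ρZ := (FZ - FC) / FT) (ρC := (0:ℝ)) (ρT := 1 - F0 / FT) (le_trans f0Z fZT) hF' (by linarith)
          (eZ0 b) (eC0 b) (eTC b) (sl 0 0 b) (sl 1 0 b) (sl 0 1 b) (sl 1 1 b)
        exact sq_core (hg0 0 0 b) (hg1 0 b) (hg2 0 b) (hg2 1 b) (hg1 1 b) (pT b) p2 p3 p4 (by linarith)
      have hCP := cp hρ0 hρ1
      refine ⟨main_sub_nonneg_of hB0 hS hCP ?_, main_sub_nonneg_of hB0 hS hCP ?_, main_sub_nonneg_of hB0 hS hCP ?_⟩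
      · have key := t2R11_B2 (YbZ := Ybar2 wA wB f h 1 0) hTpos f0C hF' fZT g0Z hG' gCT hbZT hbCT yZT sbT
        rw [R11_eq]; simp only [ρ, e00, e01, e10, e11]
        unfold DT0r DZC_B2 at key; linarith
      · have key := t2R10_B2 (YbZ := Ybar2 wA wB f h 1 0) hTpos f0C hF' fZT g0Z hG' gCT hb0Z hbZT yZT sbT
        rw [R10_eq]; simp only [ρ, e00, e01, e10, e11]
        unfold DT0r DZC_B2 at key; linarith
      · have key := t2R01_B2 (YbZ := Ybar2 wA wB f h 1 0) hTpos f0C hF' fZT g0Z hG' gCT hb0C hbCT yZT sbT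
        rw [R01_eq]; simp only [ρ, e00, e01, e10, e11]
        unfold DT0r DZC_B2 at key; linarith

end SahiT2Square

end Summit.CriticalPhenomena.PercolationContinuityZ3.Theorems
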